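import Literature.NumberTheory.QuadraticForms.PadicSquares
import Mathlib.FieldTheory.Finite.Basic
import HarnessLib

/-!
# Binary quadratic forms over `ℚ_p` represent two square classes (integer witnesses)

Topic `NumberTheory/QuadraticForms`; namespace `Literature.NumberTheory.QuadraticForms`.
Everything here is PROVED, for Mathlib's `ℚ_[p]` and every odd prime `p`.

A non-degenerate binary quadratic form over `ℚ_p` represents at least two classes of
`ℚ_p^× / (ℚ_p^×)²` (an isotropic form is universal; an anisotropic one is a multiple of the norm
form of a quadratic extension, whose norm group has index `2`): Serre, *A Course in Arithmetic*,
Ch. IV §2 with Ch. II §3.3. We prove the following elementary, witness-producing form of this,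
which is what the arithmetic application needs (two RATIONAL POINTS of an elliptic curve whose
`p`-adic heights have non-square ratio, file
`Summits/BirchSwinnertonDyer/…/PAdicOrderV2PAdicOrderThesisR2StubShadowPrimeTightness`):

* `exists_sq_add_sq_not_isSquare_padic`: for `p ≠ 2` some integer `u² + v²` is a non-zero
  non-square of `ℚ_p` (a non-residue of `𝔽_p` is a sum of two squares, Mathlib `ZMod.sq_add_sq`,
  and an integer that is a square in `ℚ_p` is a square mod `p`).
* `exists_sq_add_mul_sq_not_isSquare`: for `p ≠ 2`, `d ≠ 0`, the form `X² + dY²` represents a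
  non-square (`(0,1)` if `d` is a non-square, `(u, v/e)` if `d = e²`).
* `exists_ratio_not_isSquare_of_det_ne_zero`: `a x² + 2b xy + c y²` with `ac - b² ≠ 0` takes two
  non-zero values of non-square ratio on `ℚ_p²` (complete the square if `a ≠ 0`; if `a = 0` the
  form `y (2b x + c y)` is onto).
* `exists_rat_binaryForm_sameClass`, `exists_int_binaryForm_sameClass`: a non-zero value at a
  `ℚ_p`-point is matched, up to a square factor, at a rational and then at an INTEGER point —
  density of `ℚ` in `ℚ_p` (Mathlib `Padic.denseRange_ratCast`), continuity, and openness of square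
  classes (`padic_isSquare_of_norm_sub_one_lt`: `‖w - 1‖ < p⁻³ ⇒ w ∈ (ℚ_p^×)²`, Serre II.3.3
  Thm 4), then clearing denominators.
* `exists_int_ratio_not_isSquare_of_det_ne_zero`: the two statements combined.

## References

* J.-P. Serre, *A Course in Arithmetic*, GTM 7, Springer 1973, Ch. II §3.3 (squares in `ℚ_p`),
  Ch. IV §2.2 (binary forms; Cor. to Thm 6). [Serre1973]
-/

noncomputable section

namespace Literature.NumberTheory.QuadraticForms

/-! ### Squares in `ℚ_p`: integers, residues, and the norm form `X² + dY²` -/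

variable {p : ℕ} [hp : Fact p.Prime]

/-- If an integer `n` is a square in `ℚ_p` then it is a square modulo `p` (a square root has norm
`≤ 1`, so lies in `ℤ_p` and reduces). Same proof as the tree's
`DeuringLadic.isSquare_zmod_of_isSquare_padic` (elliptic-curve topic; restated here so that this
file depends on Mathlib only). [folklore] -/
theorem isSquare_intCast_zmod_of_isSquare_padic {n : ℤ} (h : IsSquare ((n : ℚ_[p]))) :
    IsSquare ((n : ZMod p)) := by
  obtain ⟨y, hy⟩ := h
  have hy1 : ‖y‖ ≤ 1 := by
    by_contra hlt
    push Not at hlt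
    have h1 : (1 : ℝ) < ‖y‖ * ‖y‖ := by nlinarith [norm_nonneg y]
    have h2 : ‖y‖ * ‖y‖ ≤ 1 := by
      rw [← norm_mul, ← hy]
      exact Padic.norm_int_le_one n
    linarith
  set z : ℤ_[p] := ⟨y, hy1⟩ with hz
  have hnz : ((n : ℤ_[p]) : ℚ_[p]) = ((z * z : ℤ_[p]) : ℚ_[p]) := by
    rw [PadicInt.coe_mul, PadicInt.coe_intCast]
    exact hy
  have hnz' : (n : ℤ_[p]) = z * z := PadicInt.ext hnz
  refine ⟨PadicInt.toZMod z, ?_⟩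
  rw [← map_mul, ← hnz', map_intCast]

/-- For `p ≠ 2` there are natural numbers `u, v` such that the integer `u² + v²` is non-zero and
NOT a square in `ℚ_p`: write a non-residue `t ∈ 𝔽_p` (it exists as `p` is odd, Mathlib
`FiniteField.exists_nonsquare`) as a sum of two squares `ū² + v̄²` (Mathlib `ZMod.sq_add_sq`) and
lift. [folklore] -/
theorem exists_sq_add_sq_not_isSquare_padic (hp2 : p ≠ 2) :
    ∃ u v : ℕ, ((u : ℚ_[p]) ^ 2 + (v : ℚ_[p]) ^ 2 ≠ 0) ∧
      ¬ IsSquare ((u : ℚ_[p]) ^ 2 + (v : ℚ_[p]) ^ 2) := by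
  have hchar : ringChar (ZMod p) ≠ 2 := by
    rw [ZMod.ringChar_zmod_n]
    exact hp2
  obtain ⟨t, ht⟩ := FiniteField.exists_nonsquare hchar
  obtain ⟨a, b, hab⟩ := ZMod.sq_add_sq p t
  refine ⟨a.val, b.val, ?_, ?_⟩
  · intro h0
    apply ht
    have hcast : (((a.val ^ 2 + b.val ^ 2 : ℕ) : ℤ) : ℚ_[p]) = 0 := by
      push_cast
      exact h0
    have hsq : IsSquare ((((a.val ^ 2 + b.val ^ 2 : ℕ) : ℤ)) : ZMod p) :=
      isSquare_intCast_zmod_of_isSquare_padic ⟨0, by rw [hcast, mul_zero]⟩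
    have hred : ((((a.val ^ 2 + b.val ^ 2 : ℕ) : ℤ)) : ZMod p) = t := by
      push_cast
      rw [ZMod.natCast_zmod_val, ZMod.natCast_zmod_val, hab]
    rwa [hred] at hsq
  · intro hsq
    apply ht
    have hcast : (((a.val ^ 2 + b.val ^ 2 : ℕ) : ℤ) : ℚ_[p]) =
        (a.val : ℚ_[p]) ^ 2 + (b.val : ℚ_[p]) ^ 2 := by
      push_cast
      ring
    have hsq' : IsSquare ((((a.val ^ 2 + b.val ^ 2 : ℕ) : ℤ)) : ZMod p) :=
      isSquare_intCast_zmod_of_isSquare_padic (by rw [hcast]; exact hsq)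
    have hred : ((((a.val ^ 2 + b.val ^ 2 : ℕ) : ℤ)) : ZMod p) = t := by
      push_cast
      rw [ZMod.natCast_zmod_val, ZMod.natCast_zmod_val, hab]
    rwa [hred] at hsq'

/-- **The norm-type form `X² + dY²` represents a non-square** (`p ≠ 2`, `d ≠ 0`): if `d` is not a
square take `(X, Y) = (0, 1)`; if `d = e·e` take `(u, v/e)` with `u² + v²` an integer that is a
non-square unit (`exists_sq_add_sq_not_isSquare_padic`). (Serre, *A Course in Arithmetic*, Ch. IV
§2: a non-degenerate binary form over `ℚ_p` represents at least two square classes.)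
[cite: Serre1973, Ch. II §3.3] -/
theorem exists_sq_add_mul_sq_not_isSquare (hp2 : p ≠ 2) {d : ℚ_[p]} (hd : d ≠ 0) :
    ∃ X Y : ℚ_[p], X ^ 2 + d * Y ^ 2 ≠ 0 ∧ ¬ IsSquare (X ^ 2 + d * Y ^ 2) := by
  by_cases hds : IsSquare d
  · obtain ⟨e, he⟩ := hds
    have he0 : e ≠ 0 := by
      rintro rfl
      exact hd (by rw [he, mul_zero])
    obtain ⟨u, v, h0, hns⟩ := exists_sq_add_sq_not_isSquare_padic (p := p) hp2
    refine ⟨u, v / e, ?_, ?_⟩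
    · have : (u : ℚ_[p]) ^ 2 + d * ((v : ℚ_[p]) / e) ^ 2 = (u : ℚ_[p]) ^ 2 + (v : ℚ_[p]) ^ 2 := by
        rw [he]; field_simp
      rwa [this]
    · have : (u : ℚ_[p]) ^ 2 + d * ((v : ℚ_[p]) / e) ^ 2 = (u : ℚ_[p]) ^ 2 + (v : ℚ_[p]) ^ 2 := by
        rw [he]; field_simp
      rwa [this]
  · refine ⟨0, 1, ?_, ?_⟩
    · simpa using hd
    · simpa using hds

/-- **A non-degenerate binary quadratic form over `ℚ_p` (`p ≠ 2`) represents two square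
classes**: if `a c - b² ≠ 0` there are `(x, y)`, `(x', y')` in `ℚ_p²` at which
`q = a x² + 2b xy + c y²` takes non-zero values whose ratio is NOT a square. Proof: if `a ≠ 0`,
`q = a·((x + (b/a) y)² + d y²)` with `d = (ac - b²)/a² ≠ 0`, and `X² + dY²` represents `1` and a
non-square (`exists_sq_add_mul_sq_not_isSquare`); if `a = 0` then `b ≠ 0` and
`q(x, 1) = 2b x + c` takes every value. [cite: Serre1973, Ch. II §3.3] -/
theorem exists_ratio_not_isSquare_of_det_ne_zero (hp2 : p ≠ 2) {a b c : ℚ_[p]}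
    (hdet : a * c - b * b ≠ 0) :
    ∃ x y x' y' : ℚ_[p],
      a * x ^ 2 + 2 * b * x * y + c * y ^ 2 ≠ 0 ∧ a * x' ^ 2 + 2 * b * x' * y' + c * y' ^ 2 ≠ 0 ∧
        ¬ IsSquare ((a * x ^ 2 + 2 * b * x * y + c * y ^ 2) /
            (a * x' ^ 2 + 2 * b * x' * y' + c * y' ^ 2)) := by
  have h2 : (2 : ℚ_[p]) ≠ 0 := two_ne_zero
  by_cases ha : a = 0
  · -- `q(x, 1) = 2 b x + c` is onto: hit a non-square `t` and `1`
    subst ha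
    have hb : b ≠ 0 := by
      intro hb; apply hdet; rw [hb]; ring
    obtain ⟨u, v, ht0, htns⟩ := exists_sq_add_sq_not_isSquare_padic (p := p) hp2
    set t : ℚ_[p] := (u : ℚ_[p]) ^ 2 + (v : ℚ_[p]) ^ 2 with ht
    refine ⟨(t - c) / (2 * b), 1, (1 - c) / (2 * b), 1, ?_, ?_, ?_⟩
    · have : (0 : ℚ_[p]) * ((t - c) / (2 * b)) ^ 2 + 2 * b * ((t - c) / (2 * b)) * 1 + c * 1 ^ 2 = t := by
        field_simp; ring
      rw [this]; exact ht0
    · have : (0 : ℚ_[p]) * ((1 - c) / (2 * b)) ^ 2 + 2 * b * ((1 - c) / (2 * b)) * 1 + c * 1 ^ 2 = 1 := by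
        field_simp; ring
      rw [this]; exact one_ne_zero
    · have h1 : (0 : ℚ_[p]) * ((t - c) / (2 * b)) ^ 2 + 2 * b * ((t - c) / (2 * b)) * 1 + c * 1 ^ 2 = t := by
        field_simp; ring
      have h1' : (0 : ℚ_[p]) * ((1 - c) / (2 * b)) ^ 2 + 2 * b * ((1 - c) / (2 * b)) * 1 + c * 1 ^ 2 = 1 := by
        field_simp; ring
      rw [h1, h1', div_one]
      exact htns
  · -- complete the square
    set d : ℚ_[p] := (a * c - b * b) / a ^ 2 with hd
    have hd0 : d ≠ 0 := div_ne_zero hdet (pow_ne_zero 2 ha)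
    obtain ⟨X, Y, hQ0, hQns⟩ := exists_sq_add_mul_sq_not_isSquare (p := p) hp2 hd0
    have hq : ∀ X Y : ℚ_[p],
        a * (X - b / a * Y) ^ 2 + 2 * b * (X - b / a * Y) * Y + c * Y ^ 2 = a * (X ^ 2 + d * Y ^ 2) := by
      intro X Y
      rw [hd]
      field_simp
      ring
    refine ⟨X - b / a * Y, Y, 1 - b / a * 0, 0, ?_, ?_, ?_⟩
    · rw [hq]; exact mul_ne_zero ha hQ0
    · have h10 : (1 : ℚ_[p]) ^ 2 + d * 0 ^ 2 = 1 := by ring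
      rw [hq, h10, mul_one]; exact ha
    · have h10 : (1 : ℚ_[p]) ^ 2 + d * 0 ^ 2 = 1 := by ring
      rw [hq, hq, h10, mul_one, mul_div_cancel_left₀ _ ha]
      exact hQns


/-! ### From `ℚ_p`-points to integer points: density of `ℚ` and openness of square classes -/

/-- **Square classes are open, `ℚ` is dense**: if the binary form `a x² + 2b xy + c y²` takes a
non-zero value `z₀` at a point of `ℚ_p²`, it takes a value in the SAME square class (`z/z₀` a
square, `z ≠ 0`) at a RATIONAL point. Proof: the form is continuous, the set
`{v : ‖q(v) - z₀‖ < p⁻³‖z₀‖}` is open and non-empty, `ℚ² ⊂ ℚ_p²` is dense (Mathlib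
`Padic.denseRange_ratCast`), and `‖z/z₀ - 1‖ < p⁻³` forces `z/z₀` to be a square
(`padic_isSquare_of_norm_sub_one_lt`, Serre Ch. II §3.3 Thm 4). [cite: Serre1973, Ch. II §3.3] -/
theorem exists_rat_binaryForm_sameClass {a b c x y : ℚ_[p]}
    (h0 : a * x ^ 2 + 2 * b * x * y + c * y ^ 2 ≠ 0) :
    ∃ r s : ℚ, a * (r : ℚ_[p]) ^ 2 + 2 * b * r * s + c * (s : ℚ_[p]) ^ 2 ≠ 0 ∧
      IsSquare ((a * (r : ℚ_[p]) ^ 2 + 2 * b * r * s + c * (s : ℚ_[p]) ^ 2) /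
        (a * x ^ 2 + 2 * b * x * y + c * y ^ 2)) := by
  set z₀ : ℚ_[p] := a * x ^ 2 + 2 * b * x * y + c * y ^ 2 with hz₀
  set F : ℚ_[p] × ℚ_[p] → ℚ_[p] := fun v => a * v.1 ^ 2 + 2 * b * v.1 * v.2 + c * v.2 ^ 2 with hF
  have hFc : Continuous F := by
    rw [hF]
    fun_prop
  have hp1 : (1 : ℝ) < p := by exact_mod_cast hp.out.one_lt
  have hz₀n : 0 < ‖z₀‖ := norm_pos_iff.mpr h0
  set ε : ℝ := ‖z₀‖ * (p : ℝ) ^ (-3 : ℤ) with hε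
  have hε0 : 0 < ε := mul_pos hz₀n (zpow_pos (by linarith) _)
  have hU : IsOpen (F ⁻¹' Metric.ball z₀ ε) := Metric.isOpen_ball.preimage hFc
  have hne : (F ⁻¹' Metric.ball z₀ ε).Nonempty :=
    ⟨(x, y), by simpa [Set.mem_preimage, Metric.mem_ball, hF, hz₀] using hε0⟩
  have hd : DenseRange (Prod.map ((↑) : ℚ → ℚ_[p]) ((↑) : ℚ → ℚ_[p])) :=
    (Padic.denseRange_ratCast (p := p)).prodMap (Padic.denseRange_ratCast (p := p))
  obtain ⟨⟨r, s⟩, hrs⟩ := hd.exists_mem_open hU hne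
  have hdist : ‖F ((r : ℚ_[p]), (s : ℚ_[p])) - z₀‖ < ε := by
    have := hrs
    rw [Set.mem_preimage, Metric.mem_ball, dist_eq_norm] at this
    exact this
  have hFrs : F ((r : ℚ_[p]), (s : ℚ_[p])) = a * (r : ℚ_[p]) ^ 2 + 2 * b * r * s + c * (s : ℚ_[p]) ^ 2 := by
    rw [hF]
  rw [hFrs] at hdist
  set z : ℚ_[p] := a * (r : ℚ_[p]) ^ 2 + 2 * b * r * s + c * (s : ℚ_[p]) ^ 2 with hz
  have hεlt : ε < ‖z₀‖ := by
    rw [hε]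
    have : (p : ℝ) ^ (-3 : ℤ) < 1 := zpow_lt_one_of_neg₀ hp1 (by norm_num)
    nlinarith
  have hzne : z ≠ 0 := by
    intro hz0
    rw [hz0, zero_sub, norm_neg] at hdist
    linarith
  refine ⟨r, s, hzne, ?_⟩
  have hw : ‖z / z₀ - 1‖ < (p : ℝ) ^ (-3 : ℤ) := by
    have : z / z₀ - 1 = (z - z₀) / z₀ := by field_simp
    rw [this, norm_div, div_lt_iff₀ hz₀n, mul_comm]
    exact hdist
  exact padic_isSquare_of_norm_sub_one_lt hw

/-- From a rational point to an INTEGER point in the same square class: clear denominators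
(`q(N r, N s) = N² q(r, s)` and `N²` is a square). [folklore] -/
theorem exists_int_binaryForm_sameClass {a b c x y : ℚ_[p]}
    (h0 : a * x ^ 2 + 2 * b * x * y + c * y ^ 2 ≠ 0) :
    ∃ m n : ℤ, a * (m : ℚ_[p]) ^ 2 + 2 * b * m * n + c * (n : ℚ_[p]) ^ 2 ≠ 0 ∧
      IsSquare ((a * (m : ℚ_[p]) ^ 2 + 2 * b * m * n + c * (n : ℚ_[p]) ^ 2) /
        (a * x ^ 2 + 2 * b * x * y + c * y ^ 2)) := by
  obtain ⟨r, s, hrs0, hsq⟩ := exists_rat_binaryForm_sameClass h0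
  set N : ℚ_[p] := ((r.den * s.den : ℕ) : ℚ_[p]) with hN
  have hN0 : N ≠ 0 := by
    rw [hN]
    exact_mod_cast (Nat.mul_ne_zero r.den_nz s.den_nz)
  have hm : ((r.num * s.den : ℤ) : ℚ_[p]) = N * (r : ℚ_[p]) := by
    have h : ((r.num * s.den : ℤ) : ℚ) = ((r.den * s.den : ℕ) : ℚ) * r := by
      push_cast
      rw [← Rat.mul_den_eq_num r]
      ring
    calc ((r.num * s.den : ℤ) : ℚ_[p]) = (((r.num * s.den : ℤ) : ℚ) : ℚ_[p]) := by push_cast; rfl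
      _ = ((((r.den * s.den : ℕ) : ℚ) * r : ℚ) : ℚ_[p]) := by rw [h]
      _ = N * (r : ℚ_[p]) := by rw [hN]; push_cast; rfl
  have hn : ((s.num * r.den : ℤ) : ℚ_[p]) = N * (s : ℚ_[p]) := by
    have h : ((s.num * r.den : ℤ) : ℚ) = ((r.den * s.den : ℕ) : ℚ) * s := by
      push_cast
      rw [← Rat.mul_den_eq_num s]
      ring
    calc ((s.num * r.den : ℤ) : ℚ_[p]) = (((s.num * r.den : ℤ) : ℚ) : ℚ_[p]) := by push_cast; rfl
      _ = ((((r.den * s.den : ℕ) : ℚ) * s : ℚ) : ℚ_[p]) := by rw [h]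
      _ = N * (s : ℚ_[p]) := by rw [hN]; push_cast; rfl
  refine ⟨r.num * s.den, s.num * r.den, ?_, ?_⟩
  · have key : a * (((r.num * s.den : ℤ)) : ℚ_[p]) ^ 2 + 2 * b * ((r.num * s.den : ℤ) : ℚ_[p]) *
        ((s.num * r.den : ℤ) : ℚ_[p]) + c * (((s.num * r.den : ℤ)) : ℚ_[p]) ^ 2 =
        N ^ 2 * (a * (r : ℚ_[p]) ^ 2 + 2 * b * r * s + c * (s : ℚ_[p]) ^ 2) := by
      rw [hm, hn]; ring
    push_cast at key ⊢
    rw [key]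
    exact mul_ne_zero (pow_ne_zero 2 hN0) hrs0
  · have key : a * (((r.num * s.den : ℤ)) : ℚ_[p]) ^ 2 + 2 * b * ((r.num * s.den : ℤ) : ℚ_[p]) *
        ((s.num * r.den : ℤ) : ℚ_[p]) + c * (((s.num * r.den : ℤ)) : ℚ_[p]) ^ 2 =
        N ^ 2 * (a * (r : ℚ_[p]) ^ 2 + 2 * b * r * s + c * (s : ℚ_[p]) ^ 2) := by
      rw [hm, hn]; ring
    push_cast at key ⊢
    rw [key, mul_div_assoc]
    exact IsSquare.mul ⟨N, sq N⟩ hsq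

/-- **Integer version of `exists_ratio_not_isSquare_of_det_ne_zero`**: a binary quadratic form
`a x² + 2b xy + c y²` over `ℚ_p` (`p ≠ 2`, `ac - b² ≠ 0`) takes, at two INTEGER points, non-zero
values whose ratio is not a square in `ℚ_p`. [cite: Serre1973, Ch. II §3.3] -/
theorem exists_int_ratio_not_isSquare_of_det_ne_zero (hp2 : p ≠ 2) {a b c : ℚ_[p]}
    (hdet : a * c - b * b ≠ 0) :
    ∃ m n m' n' : ℤ,
      a * (m : ℚ_[p]) ^ 2 + 2 * b * m * n + c * (n : ℚ_[p]) ^ 2 ≠ 0 ∧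
        a * (m' : ℚ_[p]) ^ 2 + 2 * b * m' * n' + c * (n' : ℚ_[p]) ^ 2 ≠ 0 ∧
        ¬ IsSquare ((a * (m : ℚ_[p]) ^ 2 + 2 * b * m * n + c * (n : ℚ_[p]) ^ 2) /
            (a * (m' : ℚ_[p]) ^ 2 + 2 * b * m' * n' + c * (n' : ℚ_[p]) ^ 2)) := by
  obtain ⟨x, y, x', y', h0, h0', hns⟩ := exists_ratio_not_isSquare_of_det_ne_zero hp2 hdet
  obtain ⟨m, n, hm0, hm⟩ := exists_int_binaryForm_sameClass h0
  obtain ⟨m', n', hm0', hm'⟩ := exists_int_binaryForm_sameClass h0'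
  refine ⟨m, n, m', n', hm0, hm0', fun hsq => hns ?_⟩
  set A := a * (m : ℚ_[p]) ^ 2 + 2 * b * m * n + c * (n : ℚ_[p]) ^ 2
  set A' := a * (m' : ℚ_[p]) ^ 2 + 2 * b * m' * n' + c * (n' : ℚ_[p]) ^ 2
  set Z := a * x ^ 2 + 2 * b * x * y + c * y ^ 2
  set Z' := a * x' ^ 2 + 2 * b * x' * y' + c * y' ^ 2
  have : Z / Z' = (A / A') * (A' / Z') / (A / Z) := by
    field_simp
  rw [this]
  exact (hsq.mul hm').div hm


end Literature.NumberTheory.QuadraticForms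

end
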